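import Mathlib
import Literature.MathematicalPhysics.QuantumFieldTheory.Balaban1983to89.B9Thm39Sum

/-!
# `Balaban1983to89.B9Eq395Small` — the "already localized" commutator terms of (3.95) and the factors of p. 412 ((3.97)), kernel-checked on 𝔅 (B9 pp. 411–412)

T. Bałaban, *Propagators for lattice gauge theories in a background field*, Commun. Math. Phys. **99**, 389–434
(1985) [Balaban1985BackgroundPropagators] (cell paper B9; PDF held `paper:balaban1985-cmp99-background-propagators`,
journal page = PDF page + 388).  Sibling of `…Balaban1983to89.B9Thm39Sum` (UNTOUCHED; its §1 `eq395_sum` types (3.95)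
as a ring identity whose THIRD summand is literally `(Chi i * Lloc i * Hm i - Hm i * (Chi i * Lloc i)) * Cl i * Hm i`,
and its §2b `firstSum_term_majorant` kernel-checks [4] (2.83) for the FIRST sum), reusing the block-majorant calculus
of [4] = [Balaban1984PropagatorsII] typed by unit pv08 (`…B6RandomWalk`: `HasMajorant`, `BlockSupp`, `hasMajorant_mul`,
`Ineq261`, `Triangle254`) read through `B9Thm34Ext.toB6`, gen-3's kernel vocabulary (`B9Thm34Inv.entry`,
`hasMajorant_id_iff`), gen-4's multiplication operators (`B9Thm37Sum.mulOp`) and gen-5's localization lemmas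
(`B9Thm39Sum.hasMajorant_localSum_right`, `firstSum_small_factor`).

CITATION HEADER (lean-in-tree rule 2026-08-18).  This module is a KERNEL-CHECKED BOOKKEEPING STEP of the published
paper [Balaban1985BackgroundPropagators], pp. 411–412 [PDF 23–24], verbatim:

(p. 411, (3.95), third sum) *"… + Σ_□[□̃Q′G′²_□Q′\*, h_□]C_□h_□ = I − R (3.95) By the same estimates as in [4], especially
(2.83)–(2.85), we can see that the operator R is small"*;

(p. 412) *"Thus we have the term □̃Q′h′_{□₀}G′_{□₀}h′²_{□₀}G′_{□₀}h′_{□₀}Q′h_□C_□h_□ [sic: Q′\* before h_□]. Let us notice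
that by the construction of the partition 𝒟′ we have h′_{□₀} = 1 on □̃, hence we have only the function h′²_{□₀} in the
above expression. We move this function to the left, i.e. we write this expression as
□̃Q′[G′_{□₀}, h′²_{□₀}]G′_{□₀}Q′\*h_□C_□h_□ + □̃Q′G′²_{□₀}Q′\*h_□C_□h_□.
The commutator in the first term gives O(M⁻¹). We consider this term as one factor in the random walk expansion. We
take the second term together with the term in the second sum we have not considered yet, i.e. we take
□̃Q′(G′²_{□₀} − G′²_□)Q′\*h_□C_□h_□. (3.97)
We have proved in [2] that if we have a difference of propagators defined on two domains, then in an estimate of this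
difference we have, besides the usual factors connected with propagators of a considered type, an exponential factor
with a distance between localizations and a closest point where a change was made. Such inequalities were proved using
only the random walk expansions, hence they are valid for all propagators we have considered in [4]. By an argument
similar to the one used in the proof of Corollary 3.5, they are valid for propagators defined by sequences {Ω_j} with Ω₀
contained in a cube for which the condition (3.25) is satisfied. Hence, they are valid in the considered case, and the
differences □̃Q′(G′²_{□₀} − G′²_□)Q′\*□ can be estimated by the usual factors multiplied by e^{−2δ₀M}. We have to notice
only that the operators may differ outside □̃₀, and the distance from □̃ to □̃₀ᶜ is at least M (on L^{−j}-scale). This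
exponential can be estimated by (2δ₀M)⁻¹ and we consider the operator (3.97) as on [sic] factor in the expansion.
Finally let us notice that terms in the third sum on the right-hand side of (3.95) are already localized and give small
factors O(M⁻¹)."*

and of the cited template [4] = [Balaban1984PropagatorsII] p. 238 [PDF 16], verbatim: *"Similar inequalities hold for
kernels of the other operators forming R, for example the operator with G′(□̃)² − G′² is small and an estimate has the
factor e^{−δ₀M} because of the usual estimate of the type (1.12) [3] connected with a change of a domain. This estimate
follows from the random walk representations (2.50) for the operators G′, G′(□̃). An estimate of the terms with the
commutator is even simpler and gives a factor O(M⁻¹)."* and *"|R(y, y′)| ≦ O(M⁻¹)e^{−δ₁d(y,y′)}(L^{j′}η)^{−d}, y, y′ ∈ 𝔅,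
y′ ∈ Λ_{j′}, (2.85)"*.

NEITHER PAPER DISPLAYS A DERIVATION of the two "O(M⁻¹)" for the commutator terms.  This module types ONE elementary
mechanism that yields them with the constants NAMED — an exponentially decaying majorant against a slowly varying
multiplier: if T has the block majorant K(y, y′) ([4] (2.51)) and |h(x′) − h(x)| ≦ ℓ₀ + ℓ₁d(y, y′) for x in the block
of y, x′ in the block of y′ (h_□ varies on the length scale ML^jη — here a HYPOTHESIS stated in the multiscale distance
d, with ℓ₀, ℓ₁ = O(M⁻¹)), then the commutator T·h − h·T has the block majorant (ℓ₀ + ℓ₁d(y, y′))K(y, y′)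
(`hasMajorant_comm_mulOp`; kernel reading [T, h](y, y′) = T(y, y′)(h(y′) − h(y)), `entry_comm_mulOp`), and
(ℓ₀ + ℓ₁d)e^{−aδ₀d} ≦ (ℓ₀ + ℓ₁(α_cδ₀)⁻¹)e^{−(a−α_c)δ₀d} (`lin_mul_exp_le`).  The alternative reading
[G′_{□₀}, h′²] = G′_{□₀}K(h′²)G′_{□₀} + (3.89)-terms (cell row C-adv4-20 (c)) is NOT typed here.

SETTING.  As in the sibling: 𝔅 = `g.Site` FINITE, operators on the functions on a lattice X with block map
`blk : X → g.Site` ([4] p. 231) are `Module.End ℝ (X → ℝ)`, the operators of (3.95) act on the functions on 𝔅 itself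
(X = 𝔅, `blk` = id, majorants = entrywise bounds by `B9Thm34Inv.hasMajorant_id_iff`); P(y) = (L^jη)^{−4} is any
positive weight with the scale-transfer property of the p. 398 remark (`B9Ineq347.ScaleTransfer`, [4] (2.60)); the
p. 412 regrouping is an identity of linear maps between two abstract real vector spaces (fine V, coarse W).

WHAT IS REPRODUCED (0 sorry; every O(·) a NAMED constant; every hypothesis of the printed shape, NAMED, none cited):
* §0 `mul_exp_neg_le`, `lin_mul_exp_le`, `abs_sq_sub_sq_le` — the real-variable facts t·e^{−ct} ≦ c⁻¹,
  (ℓ₀ + ℓ₁t)e^{−aδ₀t} ≦ (ℓ₀ + ℓ₁(αδ₀)⁻¹)e^{−(a−α)δ₀t}, |u² − v²| ≦ 2|u − v| for |u|, |v| ≦ 1.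
* §1 `hasMajorant_comm_mulOp` (+ `entry_comm_mulOp`, `hasMajorant_comm_mulOp_sq` for [T, h′²], `hasMajorant_mulOp_left`,
  `hasMajorant_mul_mulOp_right`, `mulOp_comm`, `mulOp_mul_mulOp`, `mulOp_single`) — the COMMUTATOR-WITH-A-MULTIPLIER
  majorant above, at the block level of [4] (2.51), and the one-sided localizations by |χ| ≦ 1 in front / h_□ *"at the
  end"*; `conv_majorant` — the y″-sum of [4] (2.52) for a product A·T with A ≺ θ(P y)⁻¹e^{−a_Aδ₀d(y,y″)} and
  T ≺ 1_S(y′)B₀P(y″)e^{−bδ₀d(y″,y′)}: A·T ≺ 1_S(y′)·θB₀C·c₁(δ₀, b−ρ)·e^{−ρδ₀d(y,y′)} whenever a_A ≧ α_st + ρ (scale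
  transfer at α_st with constant C, triangle inequality (2.54), symmetry, (2.61) of [4] at b − ρ) — the sibling's
  `firstSum_term_majorant` computation without the separation; `localizedSum_majorant` — Σ_□ of source-localized terms
  with overlap ≦ N.
* §2 `thirdSum_term_eq`, `thirdSum_term_majorant`, `thirdSum_majorant`, `thirdSum_small_factor` — **the third sum of
  (3.95)**, *"already localized and give small factors O(M⁻¹)"*, kernel-checked: with χ = □̃ (|χ| ≦ 1), h = h_□ (|h| ≦ 1,
  supp h ∩ 𝔅 ⊂ S_□, (ℓ₀, ℓ₁)-slowly varying in d), L_□ = Q′G′²_□Q′\* ≺ κ(P y)⁻¹e^{−a_Lδ₀d} (HYPOTHESIS `hL`, the upper bound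
  (2.83) line 1 of [4]) and C_□ ≺ B₀P(y)e^{−bδ₀d} ((3.48) for C_□, p. 409: HYPOTHESIS `hCl`), the □-term
  (□̃L_□h_□ − h_□□̃L_□)C_□h_□ = □̃[L_□, h_□]C_□h_□ has the majorant 1_{S_□}(y′)·Θ₃·e^{−ρδ₀d(y,y′)} with
  **Θ₃ = (ℓ₀ + ℓ₁(α_cδ₀)⁻¹)κB₀C·c₁(δ₀, b−ρ)** (a_L ≧ α_st + α_c + ρ), the third sum the majorant N·Θ₃·e^{−ρδ₀d(y,y′)}
  ((2.85)-shape), and for ℓ₀ = m₀M⁻¹, ℓ₁ = m₁M⁻¹ this is **O(M⁻¹) = (m₀ + m₁(α_cδ₀)⁻¹)κB₀Cc₁·M⁻¹**.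
* §3 `regroup_412` — **the p. 412 regrouping as an identity of linear maps between the fine and the coarse function
  spaces**: from □̃Q′h′_{□₀} = □̃Q′ and h′_{□₀}Q′\*h_□ = Q′\*h_□ (*"h′_{□₀} = 1 on □̃"*; DERIVED in `chi_comp_mulOp_eq_of_local` /
  `mulOp_comp_eq_of_local` from the block-locality of Q′, Q′\* and supp h_□ ⊂ □̃ — the typed content of *"by the
  construction of the partition 𝒟′"*):
  □̃Q′h′G′h′²G′h′Q′\*h_□C_□h_□ = □̃Q′[G′, h′²]G′Q′\*h_□C_□h_□ + □̃Q′G′²Q′\*h_□C_□h_□;  `hasMajorant_comm_mulOp_sq` — [G′_{□₀}, h′²_{□₀}]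
  has the block majorant (2ℓ₀ + 2ℓ₁d)K when G′_{□₀} ≺ K ((3.42)₁) and h′ is (ℓ₀, ℓ₁)-slowly varying, |h′| ≦ 1;
  `smallFactor_term_majorant` — **a factor □̃·A·h_□C_□h_□ with A ≺ θ(P y)⁻¹e^{−a_Aδ₀d}** (A = Q′[G′_{□₀}, h′²]G′_{□₀}Q′\* with
  θ = O(M⁻¹), or A = Q′(G′²_{□₀} − G′²_□)Q′\* with θ = κ_De^{−2δ₀M}: HYPOTHESIS `hA` of the printed shape) has the majorant
  1_{S_□}(y′)·θB₀Cc₁·e^{−ρδ₀d(y,y′)}.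
* §4 `term397_small_factor` — *"This exponential can be estimated by (2δ₀M)⁻¹"*: e^{−2δ₀D} ≦ (2δ₀M)⁻¹ for D ≧ M > 0
  (gen-1's `B9.exp_neg_le_inv` via the sibling's `firstSum_small_factor`); `term397_majorant` — (3.97) as a factor:
  majorant 1_{S_□}(y′)·κ_De^{−2δ₀D}B₀Cc₁·e^{−ρδ₀d(y,y′)}, ≦-ready for **O(M⁻¹) = κ_DB₀Cc₁(2δ₀)⁻¹·M⁻¹**.

WHAT IS NOT REPRODUCED (located, not claimed): (i) the [2]-difference estimate itself (*"We have proved in [2] …"*;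
cell GAPS G-B9-05) and its transfer *"By an argument similar to the one used in the proof of Corollary 3.5"* to
sequences {Ω_j} — the majorant of Q′(G′²_{□₀} − G′²_□)Q′\* with the factor e^{−2δ₀M} is the HYPOTHESIS `hA`/`hD`, never
derived; (ii) the composition of the coarse-level majorant of Q′[G′_{□₀}, h′²]G′_{□₀}Q′\* from the block-level one of
[G′_{□₀}, h′²] (§3) with those of Q′, G′_{□₀}, Q′\* — the generic (2.52)/(2.55) composition of [4] through two lattices
(unit pv21's `B6RandomWalkHom.hasMajorantHom_comp`, not imported) plus (2.63)-type y-sums; here the composed majorant is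
the hypothesis `hA`; (iii) the slow variation of h_□, h′_{□₀} in the multiscale distance d (hypothesis `hLip`:
|h(x′) − h(x)| ≦ ℓ₀ + ℓ₁d(y(x), y(x′)), ℓ₀, ℓ₁ = O(M⁻¹)) from gradient bounds of the partition of unity and the comparison
of d ([4] (2.46)) with the scaled euclidean distance (cell GAPS G-pv08-1, C-B9-21 residual); (iv) the 𝒟′ re-expansion
combinatorics of pp. 411–412 (which terms occur, *"□′ = □₀ for both operators"*, the grouping into factors) — prose
(cell row C-adv4-20 (a)–(b)); (v) the upper bound `hL` for L_□ = Q′G′²_□Q′\* ((3.42)₁ twice + Q′-row bounds) and (3.48)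
for C_□ — hypotheses, as in the sibling; (vi) (2.60)/(2.61) of [4] for THIS geometry and the metric facts of d
(hypotheses `hST`, `h261`, `htri`, `hsymm`, `hdnn`).  NOTHING of the paper's end-statement is asserted; value =
kernel-checked bookkeeping of two printed "O(M⁻¹)" and of the p. 412 regrouping, with the constants the print leaves as
O(·) made explicit — NOT summit progress.  Unit `b2b-balaban-b09-g6` (paper sub-cell B09, gen 6), SHARPEN pass 3 of
node T06.9 (G-B9-23 (a)); cell rows C-B9-23/G-B9-24, census D-b09.15.
-/

namespace Literature.MathematicalPhysics.QuantumFieldTheory.Balaban1983to89.B9Eq395Small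

open Literature.MathematicalPhysics.QuantumFieldTheory.Balaban1983to89
open Finset B9Thm37Sum

/-! ## §0  Real-variable facts -/

section RealFacts

/-- t·e^{−ct} ≦ c⁻¹ for c > 0 (all real t; from 1 + s ≦ e^s). [folklore] -/
theorem mul_exp_neg_le (c t : ℝ) (hc : 0 < c) : t * Real.exp (-(c * t)) ≤ c⁻¹ := by
  have hexp := Real.exp_pos (c * t)
  have h1 : c * t ≤ Real.exp (c * t) := by linarith [Real.add_one_le_exp (c * t)]
  have h2 : t * Real.exp (-(c * t)) * c ≤ 1 := by
    rw [Real.exp_neg]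
    calc t * (Real.exp (c * t))⁻¹ * c = (c * t) * (Real.exp (c * t))⁻¹ := by ring
      _ ≤ Real.exp (c * t) * (Real.exp (c * t))⁻¹ := mul_le_mul_of_nonneg_right h1 (inv_nonneg.mpr hexp.le)
      _ = 1 := mul_inv_cancel₀ hexp.ne'
  simpa [one_div] using (le_div_iff₀ hc).mpr h2

/-- The slowly-varying weight against an exponential: (ℓ₀ + ℓ₁t)e^{−aδ₀t} ≦ (ℓ₀ + ℓ₁(αδ₀)⁻¹)e^{−(a−α)δ₀t} for
t ≧ 0, αδ₀ > 0, ℓ₀, ℓ₁ ≧ 0 — a part α of the decay rate pays for the linear growth. [folklore] -/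
theorem lin_mul_exp_le (ℓ₀ ℓ₁ a α δ₀ t : ℝ) (hℓ₀ : 0 ≤ ℓ₀) (hℓ₁ : 0 ≤ ℓ₁) (hαδ : 0 < α * δ₀) (ht : 0 ≤ t) :
    (ℓ₀ + ℓ₁ * t) * Real.exp (-(a * δ₀ * t)) ≤ (ℓ₀ + ℓ₁ * (α * δ₀)⁻¹) * Real.exp (-((a - α) * δ₀ * t)) := by
  have hsplit : Real.exp (-(a * δ₀ * t)) = Real.exp (-(α * δ₀ * t)) * Real.exp (-((a - α) * δ₀ * t)) := by
    rw [← Real.exp_add]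
    congr 1
    ring
  have hkey : t * Real.exp (-(α * δ₀ * t)) ≤ (α * δ₀)⁻¹ := mul_exp_neg_le (α * δ₀) t hαδ
  have hE1 : Real.exp (-(α * δ₀ * t)) ≤ 1 := by
    rw [Real.exp_le_one_iff]
    have := mul_nonneg hαδ.le ht
    linarith
  have hE := Real.exp_nonneg (-((a - α) * δ₀ * t))
  rw [hsplit]
  calc (ℓ₀ + ℓ₁ * t) * (Real.exp (-(α * δ₀ * t)) * Real.exp (-((a - α) * δ₀ * t)))
      = (ℓ₀ * Real.exp (-(α * δ₀ * t)) + ℓ₁ * (t * Real.exp (-(α * δ₀ * t)))) *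
          Real.exp (-((a - α) * δ₀ * t)) := by ring
    _ ≤ (ℓ₀ * 1 + ℓ₁ * (α * δ₀)⁻¹) * Real.exp (-((a - α) * δ₀ * t)) := by
        refine mul_le_mul_of_nonneg_right (add_le_add ?_ ?_) hE
        · exact mul_le_mul_of_nonneg_left hE1 hℓ₀
        · exact mul_le_mul_of_nonneg_left hkey hℓ₁
    _ = _ := by ring

/-- |u² − v²| ≦ 2|u − v| for |u|, |v| ≦ 1 (h′² varies at most twice as fast as h′). [folklore] -/
theorem abs_sq_sub_sq_le (u v : ℝ) (hu : |u| ≤ 1) (hv : |v| ≤ 1) : |u ^ 2 - v ^ 2| ≤ 2 * |u - v| := by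
  rw [sq_sub_sq, abs_mul]
  have h2 : |u + v| ≤ 2 := (abs_add_le u v).trans (by linarith)
  exact mul_le_mul_of_nonneg_right h2 (abs_nonneg _)

end RealFacts

/-! ## §1  Commutators with multiplication operators and one-sided localizations ([4] (2.51)-level) -/

section Generic

variable {G : B6.Geometry} {X : Type}

omit G in
/-- Multiplication operators commute with each other. [folklore] -/
theorem mulOp_comm (f h : X → ℝ) : mulOp f * mulOp h = mulOp h * mulOp f := by
  apply LinearMap.ext
  intro μ
  funext x
  simp only [Module.End.mul_apply, mulOp_apply]
  ring

omit G in
/-- The product of two multiplication operators is the multiplication by the product (h′² = h′·h′). [folklore] -/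
theorem mulOp_mul_mulOp (f h : X → ℝ) : mulOp f * mulOp h = mulOp (fun x => f x * h x) := by
  apply LinearMap.ext
  intro μ
  funext x
  simp only [Module.End.mul_apply, mulOp_apply]
  ring

/-- A bounded multiplier in front (the characteristic function □̃, |χ| ≦ 1) keeps a majorant. [folklore] -/
theorem hasMajorant_mulOp_left (blk : X → G.Site) {T : Module.End ℝ (X → ℝ)} {K : G.Site → G.Site → ℝ}
    (hT : B6RandomWalk.HasMajorant blk T K) (f : X → ℝ) (hf : ∀ x, |f x| ≤ 1) :
    B6RandomWalk.HasMajorant blk (mulOp f * T) K := by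
  intro y' μ B hμ x
  rw [Module.End.mul_apply, mulOp_apply, abs_mul]
  have hb := hT y' μ B hμ x
  calc |f x| * |T μ x| ≤ 1 * (K (blk x) y' * B) := mul_le_mul (hf x) hb (abs_nonneg _) zero_le_one
    _ = K (blk x) y' * B := one_mul _

/-- **Commutator with a slowly varying multiplier** (the mechanism typed for *"The commutator in the first term gives
O(M⁻¹)"*, p. 412, and *"terms in the third sum … are already localized and give small factors O(M⁻¹)"*, p. 411): if T has
the block majorant K ([4] (2.51)) and |h(x′) − h(x)| ≦ ℓ₀ + ℓ₁d(y(x), y(x′)) (ℓ₀, ℓ₁ ≧ 0, d ≧ 0), then T·h − h·T has the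
block majorant (ℓ₀ + ℓ₁d(y, y′))K(y, y′).  Proof: ((T·h − h·T)μ)(x) = (T((h − h(x))μ))(x) and (h − h(x))μ is supported in
the block of y′ with bound (ℓ₀ + ℓ₁d(y(x), y′))|μ|. [cite: Balaban1985BackgroundPropagators, (3.95) p.411 + p.412] -/
theorem hasMajorant_comm_mulOp (blk : X → G.Site) {T : Module.End ℝ (X → ℝ)} {K : G.Site → G.Site → ℝ}
    (hT : B6RandomWalk.HasMajorant blk T K) (h : X → ℝ) (ℓ₀ ℓ₁ : ℝ) (hℓ₀ : 0 ≤ ℓ₀) (hℓ₁ : 0 ≤ ℓ₁)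
    (hdnn : ∀ a b : G.Site, 0 ≤ G.dist a b)
    (hLip : ∀ x x' : X, |h x' - h x| ≤ ℓ₀ + ℓ₁ * G.dist (blk x) (blk x')) :
    B6RandomWalk.HasMajorant blk (T * mulOp h - mulOp h * T) (fun a b => (ℓ₀ + ℓ₁ * G.dist a b) * K a b) := by
  intro y' μ B hμ x
  have hνs : B6RandomWalk.BlockSupp blk (fun x' => (h x' - h x) * μ x') y' ((ℓ₀ + ℓ₁ * G.dist (blk x) y') * B) := by
    refine ⟨mul_nonneg (add_nonneg hℓ₀ (mul_nonneg hℓ₁ (hdnn _ _))) hμ.nonneg, fun x' hx' => ?_, fun x' hx' => ?_⟩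
    · rw [abs_mul]
      have h1 := hLip x x'
      rw [hx'] at h1
      exact mul_le_mul h1 (hμ.bound x' hx') (abs_nonneg _) (add_nonneg hℓ₀ (mul_nonneg hℓ₁ (hdnn _ _)))
    · rw [hμ.off x' hx', mul_zero]
  have happ : (T * mulOp h - mulOp h * T) μ x = T (fun x' => (h x' - h x) * μ x') x := by
    have hν' : (fun x' => (h x' - h x) * μ x') = mulOp h μ - h x • μ := by
      funext x'
      simp only [Pi.sub_apply, Pi.smul_apply, smul_eq_mul, mulOp_apply]
      ring
    rw [hν', map_sub, map_smul]
    simp only [LinearMap.sub_apply, Pi.sub_apply, Module.End.mul_apply, mulOp_apply, Pi.smul_apply, smul_eq_mul]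
  rw [happ]
  calc |T (fun x' => (h x' - h x) * μ x') x| ≤ K (blk x) y' * ((ℓ₀ + ℓ₁ * G.dist (blk x) y') * B) :=
        hT y' _ _ hνs x
    _ = (ℓ₀ + ℓ₁ * G.dist (blk x) y') * K (blk x) y' * B := by ring

/-- The same for the squared multiplier h′² = h′·h′ (*"[G′_{□₀}, h′²_{□₀}]"*, p. 412): with |h′| ≦ 1 the square varies at
most twice as fast, so T·h′² − h′²·T has the block majorant (2ℓ₀ + 2ℓ₁d(y, y′))K(y, y′).
[cite: Balaban1985BackgroundPropagators, p.412] -/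
theorem hasMajorant_comm_mulOp_sq (blk : X → G.Site) {T : Module.End ℝ (X → ℝ)} {K : G.Site → G.Site → ℝ}
    (hT : B6RandomWalk.HasMajorant blk T K) (h : X → ℝ) (ℓ₀ ℓ₁ : ℝ) (hℓ₀ : 0 ≤ ℓ₀) (hℓ₁ : 0 ≤ ℓ₁)
    (hdnn : ∀ a b : G.Site, 0 ≤ G.dist a b) (hh1 : ∀ x, |h x| ≤ 1)
    (hLip : ∀ x x' : X, |h x' - h x| ≤ ℓ₀ + ℓ₁ * G.dist (blk x) (blk x')) :
    B6RandomWalk.HasMajorant blk (T * (mulOp h * mulOp h) - (mulOp h * mulOp h) * T)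
      (fun a b => (2 * ℓ₀ + 2 * ℓ₁ * G.dist a b) * K a b) := by
  rw [mulOp_mul_mulOp]
  have hLip2 : ∀ x x' : X, |h x' * h x' - h x * h x| ≤ 2 * ℓ₀ + 2 * ℓ₁ * G.dist (blk x) (blk x') := by
    intro x x'
    have h1 := abs_sq_sub_sq_le (h x') (h x) (hh1 x') (hh1 x)
    rw [pow_two, pow_two] at h1
    calc |h x' * h x' - h x * h x| ≤ 2 * |h x' - h x| := h1
      _ ≤ 2 * (ℓ₀ + ℓ₁ * G.dist (blk x) (blk x')) := mul_le_mul_of_nonneg_left (hLip x x') (by norm_num)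
      _ = 2 * ℓ₀ + 2 * ℓ₁ * G.dist (blk x) (blk x') := by ring
  exact hasMajorant_comm_mulOp blk hT _ (2 * ℓ₀) (2 * ℓ₁) (by linarith) (by linarith) hdnn hLip2

end Generic

/-! The kernel reading and the localized lemmas carry finite sets of sites of 𝔅; as in the siblings they are typed
over B9's 𝔅 = `g.Site` read through `B9Thm34Ext.toB6`. -/

section OnB

variable {g : B9.Geometry} [Fintype g.Site] [DecidableEq g.Site] {R : ℝ} {H : Prop} {X : Type}

omit [Fintype g.Site] in
/-- A multiplier applied to a point mass: h·δ_{y′} = h(y′)δ_{y′}. [folklore] -/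
theorem mulOp_single (h : g.Site → ℝ) (y' : g.Site) :
    mulOp h (Pi.single y' (1 : ℝ)) = h y' • (Pi.single y' (1 : ℝ) : g.Site → ℝ) := by
  funext x
  rw [mulOp_apply, Pi.smul_apply, smul_eq_mul]
  by_cases hx : x = y'
  · rw [hx]
  · rw [Pi.single_eq_of_ne hx, mul_zero, mul_zero]

omit [Fintype g.Site] in
/-- **The printed-kernel reading of the commutator**: [T, h](y, y′) = T(y, y′)·(h(y′) − h(y)) for operators on the
functions on 𝔅. [folklore] -/
theorem entry_comm_mulOp (T : Module.End ℝ (g.Site → ℝ)) (h : g.Site → ℝ) (y y' : g.Site) :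
    B9Thm34Inv.entry (T * mulOp h - mulOp h * T) y y' = B9Thm34Inv.entry T y y' * (h y' - h y) := by
  simp only [B9Thm34Inv.entry, LinearMap.sub_apply, Pi.sub_apply, Module.End.mul_apply, mulOp_apply]
  rw [mulOp_single, map_smul, Pi.smul_apply, smul_eq_mul]
  ring

/-- **The h_□ "at the end" localizes the source variable**: if T has the majorant K, |h| ≦ 1 and supp h only meets the
blocks of the sites in S, then T·h has the majorant 1_S(y′)K(y, y′). [cite: Balaban1985BackgroundPropagators, (3.95) p.411] -/
theorem hasMajorant_mul_mulOp_right (blk : X → g.Site) {T : Module.End ℝ (X → ℝ)} {K : g.Site → g.Site → ℝ}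
    (hT : B6RandomWalk.HasMajorant (g := B9Thm34Ext.toB6 g R H) blk T K) (h : X → ℝ) (hh : ∀ x, |h x| ≤ 1)
    (S : Finset g.Site) (hS : ∀ x, h x ≠ 0 → blk x ∈ S) :
    B6RandomWalk.HasMajorant (g := B9Thm34Ext.toB6 g R H) blk (T * mulOp h)
      (fun (a b : g.Site) => (if b ∈ S then (1 : ℝ) else 0) * K a b) := by
  intro (y' : g.Site) μ B hμ x
  by_cases hy' : y' ∈ S
  · have hμ' : B6RandomWalk.BlockSupp (g := B9Thm34Ext.toB6 g R H) blk (mulOp h μ) y' B := by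
      refine ⟨hμ.nonneg, fun x' hx' => ?_, fun x' hx' => ?_⟩
      · rw [mulOp_apply, abs_mul]
        calc |h x'| * |μ x'| ≤ 1 * B := mul_le_mul (hh x') (hμ.bound x' hx') (abs_nonneg _) zero_le_one
          _ = B := one_mul B
      · rw [mulOp_apply, hμ.off x' hx', mul_zero]
    have hb := hT y' _ B hμ' x
    rw [Module.End.mul_apply]
    have e : (fun (a b : g.Site) => (if b ∈ S then (1 : ℝ) else 0) * K a b) (blk x) y' = K (blk x) y' := by
      simp only [hy', if_true, one_mul]
    rw [e]
    exact hb
  · have hμ0 : mulOp h μ = 0 := by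
      funext x'
      rw [mulOp_apply, Pi.zero_apply]
      by_cases hx' : blk x' = y'
      · have : h x' = 0 := by
          by_contra hne
          exact hy' (hx' ▸ hS x' hne)
        rw [this, zero_mul]
      · rw [hμ.off x' hx', mul_zero]
    rw [Module.End.mul_apply, hμ0, map_zero, Pi.zero_apply, abs_zero]
    have e : (fun (a b : g.Site) => (if b ∈ S then (1 : ℝ) else 0) * K a b) (blk x) y' = 0 := by
      simp only [hy', if_false, zero_mul]
    rw [e, zero_mul]

/-- **The y″-sum of [4] (2.52) for a product A·T without separation**: if A has the block majorant
θ(P y)⁻¹e^{−a_Aδ₀d(y,y″)} and T the source-localized majorant 1_S(y′)B₀P(y″)e^{−bδ₀d(y″,y′)}, the scale transfer of the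
p. 398 remark holds at exponent α_st with constant C ([4] (2.60): `B9Ineq347.ScaleTransfer`), (2.61) of [4] holds at
b − ρ and a_A ≧ α_st + ρ (ρ ≧ 0), then A·T has the majorant 1_S(y′)·θB₀C·c₁(δ₀, b−ρ)·e^{−ρδ₀d(y,y′)}.  Route, term by term:
e^{−a_Aδ₀d(y,y″)} ≦ e^{−α_stδ₀d}e^{−ρδ₀d}; the first factor carries (P y)⁻¹P(y″) (scale transfer), the second joins
e^{−bδ₀d(y″,y′)}: ρd(y,y″) + bd(y″,y′) ≧ ρd(y,y′) + (b−ρ)d(y′,y″) ((2.54), symmetry); the y″-sum is (2.61).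
[cite: Balaban1984PropagatorsII, (2.52)–(2.54) pp.232–233 + (2.61) p.234; Balaban1985BackgroundPropagators, (3.95) p.411] -/
theorem conv_majorant (blk : X → g.Site) (d : ℕ) (δ₀ aA αst ρ b θ B₀ C : ℝ) (P : g.Site → ℝ) (S : Finset g.Site)
    (hθ : 0 ≤ θ) (hB₀ : 0 ≤ B₀) (hC : 0 ≤ C) (hP : ∀ y, 0 < P y) (hδ₀ : 0 ≤ δ₀) (hρ : 0 ≤ ρ) (hsplit : αst + ρ ≤ aA)
    (htri : B6RandomWalk.Triangle254 (B9Thm34Ext.toB6 g R H)) (hsymm : ∀ a b : g.Site, g.dist a b = g.dist b a)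
    (hdnn : ∀ a b : g.Site, 0 ≤ g.dist a b)
    (hST : B9Ineq347.ScaleTransfer g δ₀ αst C P)
    (h261 : B6RandomWalk.Ineq261 d (B9Thm34Ext.toB6 g R H) δ₀ (b - ρ))
    {A T : Module.End ℝ (X → ℝ)}
    (hA : B6RandomWalk.HasMajorant (g := B9Thm34Ext.toB6 g R H) blk A
      (fun (a y'' : g.Site) => θ * (P a)⁻¹ * Real.exp (-(aA * δ₀ * g.dist a y''))))
    (hT : B6RandomWalk.HasMajorant (g := B9Thm34Ext.toB6 g R H) blk T
      (fun (y'' b' : g.Site) => (if b' ∈ S then (1 : ℝ) else 0) *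
        (B₀ * P y'' * Real.exp (-(b * δ₀ * g.dist y'' b'))))) :
    B6RandomWalk.HasMajorant (g := B9Thm34Ext.toB6 g R H) blk (A * T)
      (fun (a b' : g.Site) => (if b' ∈ S then (1 : ℝ) else 0) * (θ * B₀ * C * B6.c1 d δ₀ (b - ρ)) *
        Real.exp (-(ρ * δ₀ * g.dist a b'))) := by
  have hK₂ : ∀ y'' b' : g.Site, 0 ≤ (if b' ∈ S then (1 : ℝ) else 0) *
      (B₀ * P y'' * Real.exp (-(b * δ₀ * g.dist y'' b'))) := fun y'' b' =>
    mul_nonneg (by split_ifs <;> norm_num) (mul_nonneg (mul_nonneg hB₀ (hP y'').le) (Real.exp_nonneg _))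
  have hAT := B6RandomWalk.hasMajorant_mul (g := B9Thm34Ext.toB6 g R H) _ hA hT hK₂
  refine B6RandomWalk.hasMajorant_mono (g := B9Thm34Ext.toB6 g R H) _ hAT fun (a b' : g.Site) => ?_
  have hcoefρ : 0 ≤ ρ * δ₀ := mul_nonneg hρ hδ₀
  have hind : 0 ≤ (if b' ∈ S then (1 : ℝ) else 0) := by split_ifs <;> norm_num
  have hterm : ∀ y'' : g.Site,
      θ * (P a)⁻¹ * Real.exp (-(aA * δ₀ * g.dist a y'')) *
          ((if b' ∈ S then (1 : ℝ) else 0) * (B₀ * P y'' * Real.exp (-(b * δ₀ * g.dist y'' b')))) ≤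
        (if b' ∈ S then (1 : ℝ) else 0) * (θ * B₀ * C) * Real.exp (-(ρ * δ₀ * g.dist a b')) *
          Real.exp (-((b - ρ) * δ₀ * g.dist b' y'')) := by
    intro y''
    -- (i) split of the exponential of A
    have hsplitexp : Real.exp (-(aA * δ₀ * g.dist a y'')) ≤
        Real.exp (-(αst * δ₀ * g.dist a y'')) * Real.exp (-(ρ * δ₀ * g.dist a y'')) := by
      rw [← Real.exp_add]
      refine Real.exp_le_exp.mpr ?_
      have h1 := mul_le_mul_of_nonneg_right hsplit (mul_nonneg hδ₀ (hdnn a y''))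
      nlinarith [h1]
    -- (ii) scale transfer (P y)⁻¹e^{−α_stδ₀d(y,y″)}P(y″) ≦ C
    have hst : (P a)⁻¹ * (Real.exp (-(αst * δ₀ * g.dist a y'')) * P y'') ≤ C := by
      have h1 := hST a y''
      calc (P a)⁻¹ * (Real.exp (-(αst * δ₀ * g.dist a y'')) * P y'') ≤ (P a)⁻¹ * (C * P a) :=
            mul_le_mul_of_nonneg_left h1 (inv_nonneg.mpr (hP a).le)
        _ = C := by rw [mul_comm C, ← mul_assoc, inv_mul_cancel₀ (hP a).ne', one_mul]
    -- (iii) triangle inequality and symmetry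
    have htri' : Real.exp (-(ρ * δ₀ * g.dist a y'')) * Real.exp (-(b * δ₀ * g.dist y'' b')) ≤
        Real.exp (-(ρ * δ₀ * g.dist a b')) * Real.exp (-((b - ρ) * δ₀ * g.dist b' y'')) := by
      rw [← Real.exp_add, ← Real.exp_add]
      refine Real.exp_le_exp.mpr ?_
      have h0 : g.dist a b' ≤ g.dist a y'' + g.dist y'' b' := htri a y'' b'
      have h1 := mul_le_mul_of_nonneg_left h0 hcoefρ
      rw [hsymm b' y'']
      nlinarith [h1]
    have hrest : 0 ≤ θ * (P a)⁻¹ * ((if b' ∈ S then (1 : ℝ) else 0) *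
        (B₀ * P y'' * Real.exp (-(b * δ₀ * g.dist y'' b')))) :=
      mul_nonneg (mul_nonneg hθ (inv_nonneg.mpr (hP a).le)) (hK₂ y'' b')
    have hkab : 0 ≤ (if b' ∈ S then (1 : ℝ) else 0) * θ * B₀ := mul_nonneg (mul_nonneg hind hθ) hB₀
    calc θ * (P a)⁻¹ * Real.exp (-(aA * δ₀ * g.dist a y'')) *
          ((if b' ∈ S then (1 : ℝ) else 0) * (B₀ * P y'' * Real.exp (-(b * δ₀ * g.dist y'' b'))))
        = Real.exp (-(aA * δ₀ * g.dist a y'')) * (θ * (P a)⁻¹ *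
            ((if b' ∈ S then (1 : ℝ) else 0) * (B₀ * P y'' * Real.exp (-(b * δ₀ * g.dist y'' b'))))) := by ring
      _ ≤ Real.exp (-(αst * δ₀ * g.dist a y'')) * Real.exp (-(ρ * δ₀ * g.dist a y'')) * (θ * (P a)⁻¹ *
            ((if b' ∈ S then (1 : ℝ) else 0) * (B₀ * P y'' * Real.exp (-(b * δ₀ * g.dist y'' b'))))) :=
          mul_le_mul_of_nonneg_right hsplitexp hrest
      _ = (if b' ∈ S then (1 : ℝ) else 0) * θ * B₀ *
            ((P a)⁻¹ * (Real.exp (-(αst * δ₀ * g.dist a y'')) * P y'')) *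
            (Real.exp (-(ρ * δ₀ * g.dist a y'')) * Real.exp (-(b * δ₀ * g.dist y'' b'))) := by ring
      _ ≤ (if b' ∈ S then (1 : ℝ) else 0) * θ * B₀ * C *
            (Real.exp (-(ρ * δ₀ * g.dist a b')) * Real.exp (-((b - ρ) * δ₀ * g.dist b' y''))) :=
          mul_le_mul (mul_le_mul_of_nonneg_left hst hkab) htri'
            (mul_nonneg (Real.exp_nonneg _) (Real.exp_nonneg _)) (mul_nonneg hkab hC)
      _ = _ := by ring
  have hpref : 0 ≤ (if b' ∈ S then (1 : ℝ) else 0) * (θ * B₀ * C) * Real.exp (-(ρ * δ₀ * g.dist a b')) :=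
    mul_nonneg (mul_nonneg hind (mul_nonneg (mul_nonneg hθ hB₀) hC)) (Real.exp_nonneg _)
  calc ∑ y'' : g.Site, θ * (P a)⁻¹ * Real.exp (-(aA * δ₀ * g.dist a y'')) *
          ((if b' ∈ S then (1 : ℝ) else 0) * (B₀ * P y'' * Real.exp (-(b * δ₀ * g.dist y'' b'))))
      ≤ ∑ y'' : g.Site, (if b' ∈ S then (1 : ℝ) else 0) * (θ * B₀ * C) * Real.exp (-(ρ * δ₀ * g.dist a b')) *
          Real.exp (-((b - ρ) * δ₀ * g.dist b' y'')) := Finset.sum_le_sum fun y'' _ => hterm y''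
    _ = (if b' ∈ S then (1 : ℝ) else 0) * (θ * B₀ * C) * Real.exp (-(ρ * δ₀ * g.dist a b')) *
          ∑ y'' : g.Site, Real.exp (-((b - ρ) * δ₀ * g.dist b' y'')) := by rw [Finset.mul_sum]
    _ ≤ (if b' ∈ S then (1 : ℝ) else 0) * (θ * B₀ * C) * Real.exp (-(ρ * δ₀ * g.dist a b')) *
          B6.c1 d δ₀ (b - ρ) := mul_le_mul_of_nonneg_left (h261 b') hpref
    _ = _ := by ring

/-- **Sums of source-localized terms**, (2.83)-type partial estimates ⇒ (2.85): if every □-term has the majorant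
1_{S_□}(y′)·Θ·e^{−ρδ₀d(y,y′)} and every site lies in at most N of the S_□, then Σ_□ has the majorant N·Θ·e^{−ρδ₀d(y,y′)}.
[cite: Balaban1984PropagatorsII, (2.85) p.238; Balaban1985BackgroundPropagators, (3.95) p.411] -/
theorem localizedSum_majorant (blk : X → g.Site) (ρ δ₀ Θ N : ℝ) {ι : Type} [Fintype ι] (S : ι → Finset g.Site)
    (Tm : ι → Module.End ℝ (X → ℝ)) (hΘ : 0 ≤ Θ)
    (hTm : ∀ i, B6RandomWalk.HasMajorant (g := B9Thm34Ext.toB6 g R H) blk (Tm i)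
      (fun (a b' : g.Site) => (if b' ∈ S i then (1 : ℝ) else 0) * Θ * Real.exp (-(ρ * δ₀ * g.dist a b'))))
    (hcnt : ∀ b' : g.Site, (∑ i, if b' ∈ S i then (1 : ℝ) else 0) ≤ N) :
    B6RandomWalk.HasMajorant (g := B9Thm34Ext.toB6 g R H) blk (∑ i, Tm i)
      (fun (a b' : g.Site) => N * (Θ * Real.exp (-(ρ * δ₀ * g.dist a b')))) := by
  refine B9Thm39Sum.hasMajorant_localSum_right (G := B9Thm34Ext.toB6 g R H) blk Tm
    (fun i (b' : g.Site) => if b' ∈ S i then (1 : ℝ) else 0)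
    (fun (a b' : g.Site) => Θ * Real.exp (-(ρ * δ₀ * g.dist a b'))) N
    (fun a b' => mul_nonneg hΘ (Real.exp_nonneg _)) (fun i => ?_) hcnt
  refine B6RandomWalk.hasMajorant_mono (g := B9Thm34Ext.toB6 g R H) _ (hTm i) fun (a b' : g.Site) => ?_
  exact le_of_eq (by ring)

end OnB

/-! ## §2  The third sum of (3.95): "already localized and give small factors O(M⁻¹)" -/

section ThirdSum

variable {g : B9.Geometry} [Fintype g.Site] [DecidableEq g.Site] {R : ℝ} {H : Prop} {X : Type}

omit [Fintype g.Site] [DecidableEq g.Site] in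
/-- The □-term of the third sum is □̃·[L_□, h_□]·(C_□h_□): (□̃L_□h_□ − h_□□̃L_□)C_□h_□ = □̃(L_□h_□ − h_□L_□)(C_□h_□), since the
multipliers □̃ and h_□ commute. [cite: Balaban1985BackgroundPropagators, (3.95) p.411] -/
theorem thirdSum_term_eq (χ h : X → ℝ) (Lloc Cl : Module.End ℝ (X → ℝ)) :
    (mulOp χ * Lloc * mulOp h - mulOp h * (mulOp χ * Lloc)) * Cl * mulOp h =
      mulOp χ * ((Lloc * mulOp h - mulOp h * Lloc) * (Cl * mulOp h)) := by
  rw [show mulOp h * (mulOp χ * Lloc) = mulOp χ * (mulOp h * Lloc) by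
    rw [← mul_assoc, mulOp_comm h χ, mul_assoc]]
  simp only [mul_sub, sub_mul, mul_assoc]

/-- **The □-term of the third sum of (3.95), majorized with its O(M⁻¹) NAMED** (entry form on 𝔅, P(y) = (L^jη)^{−4}).
Hypotheses of the printed shape: `hL` — L_□ = Q′G′²_□Q′\* ≺ κ(P y)⁻¹e^{−a_Lδ₀d(y,y″)} ([4] (2.83) line 1); `hCl` — (3.48) for
C_□ (p. 409); `hχ1` — |□̃| ≦ 1; `hh1`, `hhS` — |h_□| ≦ 1, supp h_□ ∩ 𝔅 ⊂ S_□; `hLip` — h_□ is (ℓ₀, ℓ₁)-slowly varying in d;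
`hST` — scale transfer at α_st with constant C; `h261` — (2.61) of [4] at b − ρ; the split a_L ≧ α_st + α_c + ρ with
α_cδ₀ > 0, ρ ≧ 0; (2.54), symmetry, d ≧ 0.  Conclusion: (□̃L_□h_□ − h_□□̃L_□)C_□h_□ has the majorant
1_{S_□}(y′)·(ℓ₀ + ℓ₁(α_cδ₀)⁻¹)κB₀C·c₁(δ₀, b−ρ)·e^{−ρδ₀d(y,y′)}. [cite: Balaban1985BackgroundPropagators, (3.95) p.411 + p.412] -/
theorem thirdSum_term_majorant (d : ℕ) (δ₀ aL αc αst ρ b κ ℓ₀ ℓ₁ B₀ C : ℝ) (P : g.Site → ℝ) (S : Finset g.Site)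
    (χ h : g.Site → ℝ)
    (hκ : 0 ≤ κ) (hℓ₀ : 0 ≤ ℓ₀) (hℓ₁ : 0 ≤ ℓ₁) (hB₀ : 0 ≤ B₀) (hC : 0 ≤ C) (hP : ∀ y, 0 < P y) (hδ₀ : 0 ≤ δ₀)
    (hαc : 0 < αc * δ₀) (hρ : 0 ≤ ρ) (hsplit : αst + αc + ρ ≤ aL)
    (htri : B6RandomWalk.Triangle254 (B9Thm34Ext.toB6 g R H)) (hsymm : ∀ a b : g.Site, g.dist a b = g.dist b a)
    (hdnn : ∀ a b : g.Site, 0 ≤ g.dist a b)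
    (hST : B9Ineq347.ScaleTransfer g δ₀ αst C P)
    (h261 : B6RandomWalk.Ineq261 d (B9Thm34Ext.toB6 g R H) δ₀ (b - ρ))
    (hχ1 : ∀ y, |χ y| ≤ 1) (hh1 : ∀ y, |h y| ≤ 1) (hhS : ∀ y, h y ≠ 0 → y ∈ S)
    (hLip : ∀ y y' : g.Site, |h y' - h y| ≤ ℓ₀ + ℓ₁ * g.dist y y')
    {Lloc Cl : Module.End ℝ (g.Site → ℝ)}
    (hL : B6RandomWalk.HasMajorant (g := B9Thm34Ext.toB6 g R H) (fun x : g.Site => x) Lloc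
      (fun (a y'' : g.Site) => κ * (P a)⁻¹ * Real.exp (-(aL * δ₀ * g.dist a y''))))
    (hCl : B6RandomWalk.HasMajorant (g := B9Thm34Ext.toB6 g R H) (fun x : g.Site => x) Cl
      (fun (y'' b' : g.Site) => B₀ * P y'' * Real.exp (-(b * δ₀ * g.dist y'' b')))) :
    B6RandomWalk.HasMajorant (g := B9Thm34Ext.toB6 g R H) (fun x : g.Site => x)
      ((mulOp χ * Lloc * mulOp h - mulOp h * (mulOp χ * Lloc)) * Cl * mulOp h)
      (fun (a b' : g.Site) => (if b' ∈ S then (1 : ℝ) else 0) *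
        ((ℓ₀ + ℓ₁ * (αc * δ₀)⁻¹) * κ * B₀ * C * B6.c1 d δ₀ (b - ρ)) * Real.exp (-(ρ * δ₀ * g.dist a b'))) := by
  rw [thirdSum_term_eq]
  -- the commutator [L_□, h_□]
  have hcomm := hasMajorant_comm_mulOp (G := B9Thm34Ext.toB6 g R H) (fun x : g.Site => x) hL h ℓ₀ ℓ₁ hℓ₀ hℓ₁
    hdnn hLip
  -- absorb the slowly varying weight into the exponential
  have hcomm' : B6RandomWalk.HasMajorant (g := B9Thm34Ext.toB6 g R H) (fun x : g.Site => x)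
      (Lloc * mulOp h - mulOp h * Lloc)
      (fun (a y'' : g.Site) => (ℓ₀ + ℓ₁ * (αc * δ₀)⁻¹) * κ * (P a)⁻¹ *
        Real.exp (-((aL - αc) * δ₀ * g.dist a y''))) := by
    refine B6RandomWalk.hasMajorant_mono (g := B9Thm34Ext.toB6 g R H) _ hcomm fun (a y'' : g.Site) => ?_
    have h1 := lin_mul_exp_le ℓ₀ ℓ₁ aL αc δ₀ (g.dist a y'') hℓ₀ hℓ₁ hαc (hdnn a y'')
    have h2 : 0 ≤ κ * (P a)⁻¹ := mul_nonneg hκ (inv_nonneg.mpr (hP a).le)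
    calc (ℓ₀ + ℓ₁ * g.dist a y'') * (κ * (P a)⁻¹ * Real.exp (-(aL * δ₀ * g.dist a y'')))
        = κ * (P a)⁻¹ * ((ℓ₀ + ℓ₁ * g.dist a y'') * Real.exp (-(aL * δ₀ * g.dist a y''))) := by ring
      _ ≤ κ * (P a)⁻¹ * ((ℓ₀ + ℓ₁ * (αc * δ₀)⁻¹) * Real.exp (-((aL - αc) * δ₀ * g.dist a y''))) :=
          mul_le_mul_of_nonneg_left h1 h2
      _ = _ := by ring
  -- C_□h_□, localized at the source
  have hClh := hasMajorant_mul_mulOp_right (R := R) (H := H) (fun x : g.Site => x) hCl h hh1 S (fun x hx => hhS x hx)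
  -- the y″-sum
  have hconv := conv_majorant (R := R) (H := H) (fun x : g.Site => x) d δ₀ (aL - αc) αst ρ b
    ((ℓ₀ + ℓ₁ * (αc * δ₀)⁻¹) * κ) B₀ C P S
    (mul_nonneg (add_nonneg hℓ₀ (mul_nonneg hℓ₁ (inv_nonneg.mpr hαc.le))) hκ) hB₀ hC hP hδ₀ hρ (by linarith)
    htri hsymm hdnn hST h261 hcomm' hClh
  -- the cut-off □̃ in front
  have hcut := hasMajorant_mulOp_left (G := B9Thm34Ext.toB6 g R H) (fun x : g.Site => x) hconv χ hχ1
  refine B6RandomWalk.hasMajorant_mono (g := B9Thm34Ext.toB6 g R H) _ hcut fun (a b' : g.Site) => ?_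
  exact le_of_eq (by ring)

/-- **The third sum of (3.95) is (2.85)-small**: summed over □ with the overlap of the S_□ at most N, the majorant is
N·Θ₃·e^{−ρδ₀d(y,y′)}, Θ₃ = (ℓ₀ + ℓ₁(α_cδ₀)⁻¹)κB₀Cc₁(δ₀, b−ρ) (`localizedSum_majorant` applied to `thirdSum_term_majorant`).
[cite: Balaban1985BackgroundPropagators, (3.95) p.411 + p.412; Balaban1984PropagatorsII, (2.85) p.238] -/
theorem thirdSum_majorant (d : ℕ) (δ₀ aL αc αst ρ b κ ℓ₀ ℓ₁ B₀ C N : ℝ) (P : g.Site → ℝ) {ι : Type} [Fintype ι]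
    (S : ι → Finset g.Site) (χ h : ι → g.Site → ℝ)
    (hκ : 0 ≤ κ) (hℓ₀ : 0 ≤ ℓ₀) (hℓ₁ : 0 ≤ ℓ₁) (hB₀ : 0 ≤ B₀) (hC : 0 ≤ C) (hP : ∀ y, 0 < P y) (hδ₀ : 0 ≤ δ₀)
    (hαc : 0 < αc * δ₀) (hρ : 0 ≤ ρ) (hsplit : αst + αc + ρ ≤ aL)
    (htri : B6RandomWalk.Triangle254 (B9Thm34Ext.toB6 g R H)) (hsymm : ∀ a b : g.Site, g.dist a b = g.dist b a)
    (hdnn : ∀ a b : g.Site, 0 ≤ g.dist a b)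
    (hST : B9Ineq347.ScaleTransfer g δ₀ αst C P)
    (h261 : B6RandomWalk.Ineq261 d (B9Thm34Ext.toB6 g R H) δ₀ (b - ρ))
    (hχ1 : ∀ i y, |χ i y| ≤ 1) (hh1 : ∀ i y, |h i y| ≤ 1) (hhS : ∀ i y, h i y ≠ 0 → y ∈ S i)
    (hLip : ∀ i (y y' : g.Site), |h i y' - h i y| ≤ ℓ₀ + ℓ₁ * g.dist y y')
    (hcnt : ∀ b' : g.Site, (∑ i, if b' ∈ S i then (1 : ℝ) else 0) ≤ N)
    (Lloc Cl : ι → Module.End ℝ (g.Site → ℝ))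
    (hL : ∀ i, B6RandomWalk.HasMajorant (g := B9Thm34Ext.toB6 g R H) (fun x : g.Site => x) (Lloc i)
      (fun (a y'' : g.Site) => κ * (P a)⁻¹ * Real.exp (-(aL * δ₀ * g.dist a y''))))
    (hCl : ∀ i, B6RandomWalk.HasMajorant (g := B9Thm34Ext.toB6 g R H) (fun x : g.Site => x) (Cl i)
      (fun (y'' b' : g.Site) => B₀ * P y'' * Real.exp (-(b * δ₀ * g.dist y'' b')))) :
    B6RandomWalk.HasMajorant (g := B9Thm34Ext.toB6 g R H) (fun x : g.Site => x)
      (∑ i, (mulOp (χ i) * Lloc i * mulOp (h i) - mulOp (h i) * (mulOp (χ i) * Lloc i)) * Cl i * mulOp (h i))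
      (fun (a b' : g.Site) => N * (((ℓ₀ + ℓ₁ * (αc * δ₀)⁻¹) * κ * B₀ * C * B6.c1 d δ₀ (b - ρ)) *
        Real.exp (-(ρ * δ₀ * g.dist a b')))) :=
  localizedSum_majorant (R := R) (H := H) (fun x : g.Site => x) ρ δ₀ _ N S _
    (mul_nonneg (mul_nonneg (mul_nonneg (mul_nonneg
      (add_nonneg hℓ₀ (mul_nonneg hℓ₁ (inv_nonneg.mpr hαc.le))) hκ) hB₀) hC) (B6RandomWalk.c1_nonneg d δ₀ _))
    (fun i => thirdSum_term_majorant d δ₀ aL αc αst ρ b κ ℓ₀ ℓ₁ B₀ C P (S i) (χ i) (h i) hκ hℓ₀ hℓ₁ hB₀ hC hP hδ₀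
      hαc hρ hsplit htri hsymm hdnn hST h261 (hχ1 i) (hh1 i) (hhS i) (hLip i) (hL i) (hCl i)) hcnt

omit [Fintype g.Site] [DecidableEq g.Site] in
/-- **"give small factors O(M⁻¹)"** with the O(·) explicit: for slow-variation moduli ℓ₀ = m₀M⁻¹, ℓ₁ = m₁M⁻¹ (h_□ varies
on the scale ML^jη) the constant Θ₃ of `thirdSum_majorant` is (m₀ + m₁(α_cδ₀)⁻¹)κB₀Cc₁·M⁻¹.
[cite: Balaban1985BackgroundPropagators, p.412] -/
theorem thirdSum_small_factor (m₀ m₁ αc δ₀ κ B₀ C c M : ℝ) :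
    (m₀ * M⁻¹ + m₁ * M⁻¹ * (αc * δ₀)⁻¹) * κ * B₀ * C * c = ((m₀ + m₁ * (αc * δ₀)⁻¹) * κ * B₀ * C * c) * M⁻¹ := by
  ring

end ThirdSum

/-! ## §3  The p. 412 regrouping and the commutator factor □̃Q′[G′_{□₀}, h′²_{□₀}]G′_{□₀}Q′\*h_□C_□h_□ -/

section P412

variable {V W : Type*} [AddCommGroup V] [Module ℝ V] [AddCommGroup W] [Module ℝ W]

/-- **The p. 412 regrouping**, an identity of linear maps between the fine (V) and the coarse (W) function spaces:
if □̃Q′h′ = □̃Q′ (`h1`) and h′Q′\*h_□ = Q′\*h_□ (`h2`) — *"by the construction of the partition 𝒟′ we have h′_{□₀} = 1 on □̃"*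
— then □̃Q′h′G′h′²G′h′Q′\*h_□C_□h_□ = □̃Q′[G′, h′²]G′Q′\*h_□C_□h_□ + □̃Q′G′²Q′\*h_□C_□h_□ (*"We move this function to the left"*).
[cite: Balaban1985BackgroundPropagators, p.412] -/
theorem regroup_412 (Q : V →ₗ[ℝ] W) (Qs : W →ₗ[ℝ] V) (G H' : Module.End ℝ V) (Chi Hm C : Module.End ℝ W)
    (h1 : Chi ∘ₗ Q ∘ₗ H' = Chi ∘ₗ Q) (h2 : H' ∘ₗ Qs ∘ₗ Hm = Qs ∘ₗ Hm) :
    Chi ∘ₗ Q ∘ₗ H' ∘ₗ G ∘ₗ (H' * H') ∘ₗ G ∘ₗ H' ∘ₗ Qs ∘ₗ Hm ∘ₗ C ∘ₗ Hm =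
      Chi ∘ₗ Q ∘ₗ (G * (H' * H') - (H' * H') * G) ∘ₗ G ∘ₗ Qs ∘ₗ Hm ∘ₗ C ∘ₗ Hm +
        Chi ∘ₗ Q ∘ₗ (G * G) ∘ₗ Qs ∘ₗ Hm ∘ₗ C ∘ₗ Hm := by
  have h1' : ∀ v, Chi (Q (H' v)) = Chi (Q v) := fun v => by
    simpa [LinearMap.comp_apply] using LinearMap.congr_fun h1 v
  have h2' : ∀ w, H' (Qs (Hm w)) = Qs (Hm w) := fun w => by
    simpa [LinearMap.comp_apply] using LinearMap.congr_fun h2 w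
  apply LinearMap.ext
  intro w
  simp only [LinearMap.comp_apply, LinearMap.add_apply, LinearMap.sub_apply, Module.End.mul_apply, map_sub]
  rw [h2', h1', h1', h1']
  abel

end P412

section P412Local

variable {X S : Type} [DecidableEq S]

/-- `h1` of `regroup_412` DERIVED: if (Q′f)(y) depends only on f on the block of y (`hQ`, the block averaging of
p. 393), h′ = 1 on the blocks of the sites of □̃ ∩ 𝔅 = S_χ (`hh'`) and χ = □̃ vanishes off S_χ, then □̃Q′h′ = □̃Q′.
[cite: Balaban1985BackgroundPropagators, p.412] -/
theorem chi_comp_mulOp_eq_of_local (blk : X → S) (Q : (X → ℝ) →ₗ[ℝ] (S → ℝ))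
    (hQ : ∀ (f f' : X → ℝ) (y : S), (∀ x, blk x = y → f x = f' x) → Q f y = Q f' y)
    (Sχ : Finset S) (h' : X → ℝ) (hh' : ∀ x, blk x ∈ Sχ → h' x = 1) (χ : S → ℝ) (hχ : ∀ y, y ∉ Sχ → χ y = 0) :
    mulOp χ ∘ₗ Q ∘ₗ mulOp h' = mulOp χ ∘ₗ Q := by
  apply LinearMap.ext
  intro f
  funext y
  simp only [LinearMap.comp_apply, mulOp_apply]
  by_cases hy : y ∈ Sχ
  · congr 1
    refine hQ _ _ y fun x hx => ?_
    rw [mulOp_apply, hh' x (hx ▸ hy), one_mul]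
  · rw [hχ y hy, zero_mul, zero_mul]

/-- `h2` of `regroup_412` DERIVED: if (Q′\*u)(x) vanishes when u vanishes at the site whose block contains x (`hQs`),
h′ = 1 on the blocks of the sites of S_χ and supp h_□ ∩ 𝔅 ⊂ S_χ (□ ⊂ □̃), then h′Q′\*h_□ = Q′\*h_□.
[cite: Balaban1985BackgroundPropagators, p.412] -/
theorem mulOp_comp_eq_of_local (blk : X → S) (Qs : (S → ℝ) →ₗ[ℝ] (X → ℝ))
    (hQs : ∀ (u : S → ℝ) (x : X), u (blk x) = 0 → Qs u x = 0)
    (Sχ : Finset S) (h' : X → ℝ) (hh' : ∀ x, blk x ∈ Sχ → h' x = 1) (hc : S → ℝ)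
    (hhc : ∀ y, hc y ≠ 0 → y ∈ Sχ) :
    mulOp h' ∘ₗ Qs ∘ₗ mulOp hc = Qs ∘ₗ mulOp hc := by
  apply LinearMap.ext
  intro u
  funext x
  simp only [LinearMap.comp_apply, mulOp_apply]
  by_cases hx : blk x ∈ Sχ
  · rw [hh' x hx, one_mul]
  · have h0 : (mulOp hc u) (blk x) = 0 := by
      rw [mulOp_apply]
      have : hc (blk x) = 0 := by
        by_contra hne
        exact hx (hhc _ hne)
      rw [this, zero_mul]
    rw [hQs _ x h0, mul_zero]

end P412Local

section Factors

variable {g : B9.Geometry} [Fintype g.Site] [DecidableEq g.Site] {R : ℝ} {H : Prop} {X : Type}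

/-- **A factor □̃·A·h_□C_□h_□ with a small middle operator** (entry form on 𝔅): if A has the majorant θ(P y)⁻¹e^{−a_Aδ₀d(y,y″)}
— A = Q′[G′_{□₀}, h′²_{□₀}]G′_{□₀}Q′\* with θ = O(M⁻¹) (*"The commutator in the first term gives O(M⁻¹)"*), or A = Q′(G′²_{□₀} −
G′²_□)Q′\* with θ = κ_De^{−2δ₀M} (*"the usual factors multiplied by e^{−2δ₀M}"*): HYPOTHESIS `hA`, never derived here —
C_□ obeys (3.48) (`hCl`), |□̃| ≦ 1, |h_□| ≦ 1, supp h_□ ∩ 𝔅 ⊂ S_□, and a_A ≧ α_st + ρ with the scale transfer / (2.61) /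
(2.54) inputs of `conv_majorant`, then □̃·A·h_□C_□h_□ has the majorant 1_{S_□}(y′)·θB₀C·c₁(δ₀, b−ρ)·e^{−ρδ₀d(y,y′)}.
[cite: Balaban1985BackgroundPropagators, p.412 + (3.97)] -/
theorem smallFactor_term_majorant (d : ℕ) (δ₀ aA αst ρ b θ B₀ C : ℝ) (P : g.Site → ℝ) (S : Finset g.Site)
    (χ h : g.Site → ℝ)
    (hθ : 0 ≤ θ) (hB₀ : 0 ≤ B₀) (hC : 0 ≤ C) (hP : ∀ y, 0 < P y) (hδ₀ : 0 ≤ δ₀) (hρ : 0 ≤ ρ) (hsplit : αst + ρ ≤ aA)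
    (htri : B6RandomWalk.Triangle254 (B9Thm34Ext.toB6 g R H)) (hsymm : ∀ a b : g.Site, g.dist a b = g.dist b a)
    (hdnn : ∀ a b : g.Site, 0 ≤ g.dist a b)
    (hST : B9Ineq347.ScaleTransfer g δ₀ αst C P)
    (h261 : B6RandomWalk.Ineq261 d (B9Thm34Ext.toB6 g R H) δ₀ (b - ρ))
    (hχ1 : ∀ y, |χ y| ≤ 1) (hh1 : ∀ y, |h y| ≤ 1) (hhS : ∀ y, h y ≠ 0 → y ∈ S)
    {A Cl : Module.End ℝ (g.Site → ℝ)}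
    (hA : B6RandomWalk.HasMajorant (g := B9Thm34Ext.toB6 g R H) (fun x : g.Site => x) A
      (fun (a y'' : g.Site) => θ * (P a)⁻¹ * Real.exp (-(aA * δ₀ * g.dist a y''))))
    (hCl : B6RandomWalk.HasMajorant (g := B9Thm34Ext.toB6 g R H) (fun x : g.Site => x) Cl
      (fun (y'' b' : g.Site) => B₀ * P y'' * Real.exp (-(b * δ₀ * g.dist y'' b')))) :
    B6RandomWalk.HasMajorant (g := B9Thm34Ext.toB6 g R H) (fun x : g.Site => x)
      (mulOp χ * A * (mulOp h * Cl * mulOp h))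
      (fun (a b' : g.Site) => (if b' ∈ S then (1 : ℝ) else 0) * (θ * B₀ * C * B6.c1 d δ₀ (b - ρ)) *
        Real.exp (-(ρ * δ₀ * g.dist a b'))) := by
  -- h_□C_□h_□ localized at the source (the h_□ in front only costs |h_□| ≦ 1)
  have hT : B6RandomWalk.HasMajorant (g := B9Thm34Ext.toB6 g R H) (fun x : g.Site => x) (mulOp h * Cl * mulOp h)
      (fun (y'' b' : g.Site) => (if b' ∈ S then (1 : ℝ) else 0) *
        (B₀ * P y'' * Real.exp (-(b * δ₀ * g.dist y'' b')))) := by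
    rw [mul_assoc]
    exact hasMajorant_mulOp_left (G := B9Thm34Ext.toB6 g R H) (fun x : g.Site => x)
      (hasMajorant_mul_mulOp_right (R := R) (H := H) (fun x : g.Site => x) hCl h hh1 S (fun x hx => hhS x hx)) h hh1
  have hconv := conv_majorant (R := R) (H := H) (fun x : g.Site => x) d δ₀ aA αst ρ b θ B₀ C P S hθ hB₀ hC hP hδ₀ hρ
    hsplit htri hsymm hdnn hST h261 hA hT
  rw [mul_assoc]
  exact hasMajorant_mulOp_left (G := B9Thm34Ext.toB6 g R H) (fun x : g.Site => x) hconv χ hχ1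

end Factors

/-! ## §4  (3.97): "the usual factors multiplied by e^{−2δ₀M} … This exponential can be estimated by (2δ₀M)⁻¹" -/

section Eq397

variable {g : B9.Geometry} [Fintype g.Site] [DecidableEq g.Site] {R : ℝ} {H : Prop}

/-- *"the distance from □̃ to □̃₀ᶜ is at least M (on L^{−j}-scale). This exponential can be estimated by (2δ₀M)⁻¹"*: for a
separation D ≧ M > 0 and δ₀ > 0, e^{−2δ₀D} ≦ (2δ₀M)⁻¹ (e^{−s} ≦ s⁻¹). [cite: Balaban1985BackgroundPropagators, p.412] -/
theorem term397_small_factor (δ₀ D M : ℝ) (hδ₀ : 0 < δ₀) (hM : 0 < M) (hD : M ≤ D) :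
    Real.exp (-(2 * δ₀ * D)) ≤ (2 * δ₀ * M)⁻¹ :=
  B9Thm39Sum.firstSum_small_factor 2 δ₀ D M (by linarith) hM hD

/-- **(3.97) as a factor of the expansion**: if the difference D = Q′(G′²_{□₀} − G′²_□)Q′\* has the majorant
κ_D·e^{−2δ₀D_□}·(P y)⁻¹e^{−a_Dδ₀d(y,y″)} (*"the usual factors multiplied by e^{−2δ₀M}"*, D_□ ≧ M the distance from □̃ to □̃₀ᶜ:
the [2]-difference estimate transferred to sequences {Ω_j} — HYPOTHESIS `hD`, cell GAPS G-B9-05, never derived here), then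
□̃·D·h_□C_□h_□ has the majorant 1_{S_□}(y′)·κ_De^{−2δ₀D_□}B₀C·c₁(δ₀, b−ρ)·e^{−ρδ₀d(y,y′)}, whose constant is
≦ κ_DB₀Cc₁·(2δ₀M)⁻¹ by `term397_small_factor`. [cite: Balaban1985BackgroundPropagators, (3.97) p.412] -/
theorem term397_majorant (d : ℕ) (δ₀ aD αst ρ b κD Dsep B₀ C : ℝ) (P : g.Site → ℝ) (S : Finset g.Site)
    (χ h : g.Site → ℝ)
    (hκD : 0 ≤ κD) (hB₀ : 0 ≤ B₀) (hC : 0 ≤ C) (hP : ∀ y, 0 < P y) (hδ₀ : 0 ≤ δ₀) (hρ : 0 ≤ ρ) (hsplit : αst + ρ ≤ aD)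
    (htri : B6RandomWalk.Triangle254 (B9Thm34Ext.toB6 g R H)) (hsymm : ∀ a b : g.Site, g.dist a b = g.dist b a)
    (hdnn : ∀ a b : g.Site, 0 ≤ g.dist a b)
    (hST : B9Ineq347.ScaleTransfer g δ₀ αst C P)
    (h261 : B6RandomWalk.Ineq261 d (B9Thm34Ext.toB6 g R H) δ₀ (b - ρ))
    (hχ1 : ∀ y, |χ y| ≤ 1) (hh1 : ∀ y, |h y| ≤ 1) (hhS : ∀ y, h y ≠ 0 → y ∈ S)
    {D Cl : Module.End ℝ (g.Site → ℝ)}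
    (hD : B6RandomWalk.HasMajorant (g := B9Thm34Ext.toB6 g R H) (fun x : g.Site => x) D
      (fun (a y'' : g.Site) => κD * Real.exp (-(2 * δ₀ * Dsep)) * (P a)⁻¹ * Real.exp (-(aD * δ₀ * g.dist a y''))))
    (hCl : B6RandomWalk.HasMajorant (g := B9Thm34Ext.toB6 g R H) (fun x : g.Site => x) Cl
      (fun (y'' b' : g.Site) => B₀ * P y'' * Real.exp (-(b * δ₀ * g.dist y'' b')))) :
    B6RandomWalk.HasMajorant (g := B9Thm34Ext.toB6 g R H) (fun x : g.Site => x)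
      (mulOp χ * D * (mulOp h * Cl * mulOp h))
      (fun (a b' : g.Site) => (if b' ∈ S then (1 : ℝ) else 0) *
        (κD * Real.exp (-(2 * δ₀ * Dsep)) * B₀ * C * B6.c1 d δ₀ (b - ρ)) * Real.exp (-(ρ * δ₀ * g.dist a b'))) :=
  smallFactor_term_majorant d δ₀ aD αst ρ b (κD * Real.exp (-(2 * δ₀ * Dsep))) B₀ C P S χ h
    (mul_nonneg hκD (Real.exp_nonneg _)) hB₀ hC hP hδ₀ hρ hsplit htri hsymm hdnn hST h261 hχ1 hh1 hhS hD hCl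

end Eq397

end Literature.MathematicalPhysics.QuantumFieldTheory.Balaban1983to89.B9Eq395Small
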